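import Mathlib.Computability.Encoding
import Mathlib.Data.Nat.Prime.Basic
import Mathlib.Data.Nat.ModEq
import Mathlib.Data.ZMod.Basic
import Mathlib.GroupTheory.OrderOfElement
import Literature.Computability.Complexity.BoolEncodings
import Literature.Computability.Complexity.Classes
import Literature.Computability.Cryptography.QubitRegister
import Literature.Computability.Cryptography.QuantumCircuit
import Literature.Computability.Cryptography.ClassBQP
import Literature.Computability.QuantumComplexity.Factoring
import Literature.Computability.Cryptography.PQCWave0
import HarnessLib

-- provenance: harness21/H21/H21/Statements/PQC/Shor.lean @ 3d603bd (interim HEAD d8f2665); M5 mechanical rewrite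
/-!
# Shor's algorithm: factoring and discrete logarithms in BQP (family PQC, outline §3)

Family `PQC` (trunk `CryptoQuantFine`), statement file `PQC/Shor`:

* **pqc.S27** `mem_BQP_iff` — the definition of `BQP` (home id): languages decided with error
  `≤ 1/3` by poly-time uniform families of quantum circuits over the finite universal gate set
  Clifford+T `{H, S, T, CNOT}` (Bernstein–Vazirani 1997; Yao 1993). The class itself is
  `Literature.Computability.Cryptography.BQP` (prelude Q3, `ClassBQP`); this file restates its unfolding in the
  `Literature.PQC` namespace with the inventory id.
* **pqc.S06** Shor's theorem (Shor 1997, §§5–6): `FACT_mem_BQP : FACT ∈ BQP` (decision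
  version), `isQSolvable_factoring` (the prime factorisation `Nat.primeFactorsList` — Wave0 uses
  Mathlib's function directly, no alias — is computable in FBQP form) and `isQSolvable_dlog` (discrete logarithms modulo a prime with a
  given primitive root are computable in bounded-error quantum polynomial time), with the local
  definitions `IsDLogInstance`, `dlogSolutions`, `encodeDLogInstance`.

## Sources

* P. W. Shor, *Polynomial-time algorithms for prime factorization and discrete logarithms on a
  quantum computer*, SIAM J. Comput. 26 (1997), 1484–1509, §5 (factoring), §6 (discrete log).
* E. Bernstein, U. Vazirani, *Quantum complexity theory*, SIAM J. Comput. 26 (1997), Def. 8.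
* A. C.-C. Yao, *Quantum circuit complexity*, FOCS 1993.

## Mathlib / H21

Used from Mathlib: `Language`, `Computability.encodingNatBool`, `Computability.encodeNat`,
`Computability.decodeNat`, `Nat.Prime`, `Nat.primeFactorsList`, `Nat.ModEq` (`≡ [MOD p]`),
`ZMod`, `orderOf`, `List.IsPrefix` (`<+:`). Mathlib has no complexity classes and no discrete
logarithm problem (searched: `BQP`, `discreteLog`, `DLog`, `dlog`); the classes come from the H21
preludes (`Literature.Computability.Cryptography.BQP`, `IsQSolvable`, `QCircuitFamily`, `cliffordT`), `FACT` from
`Literature.Statements.PQC.Factoring`, and the Boolean encoding combinators `pairBool` /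
`encodingListNatBool = encodingNatBool.listBool` from G01 `BoolEncodings`.

## Design choices

* This file does **not** import `Literature.Statements.PQC.LatticeComplexity`, `…LWEHardness` or
  `…RingLWE`: those declare provisional `Literature.PQC.QCircuit`, `PromiseBQP`, … which would be
  ambiguous with the `Literature.CryptoQuantFine` names opened here (outline R12).
* Search problems are stated with Q3's `IsQSolvable R`: the family is measured on *all* wires and
  the answer must be a *prefix* of the measured string (FBQP convention of `ClassBQP`); the
  post-processing (continued fractions, gcds, retries) of Shor's algorithm is classical
  polynomial time and is folded into the circuit family, so the `2/3` success bound is the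
  standard amplified form of Shor's `Ω(1 / log log N)` per-run bound.
* Discrete log instances follow Shor §6: a prime `p`, a primitive root `g` mod `p`
  (`orderOf (g : ZMod p) = p - 1`, equivalently Mathlib's `IsPrimitiveRoot (g : ZMod p) (p - 1)`;
  `p - 1` is not a junk subtraction since `p.Prime` gives `2 ≤ p`) and a unit `y` mod `p`; the input is the Boolean encoding of
  the triple `(p, (g, y))` by iterated `pairBool`. On strings that are not encodings of valid
  instances the relation is trivially satisfied (every output is accepted), so the statement
  constrains the family exactly on the promise, as in print.
-/

noncomputable section

namespace Literature.Computability.Cryptography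

open _root_.Computability Nat Complexity

/-! ### pqc.S27: the definition of BQP -/

/-- **pqc.S27** (definition of BQP; Bernstein–Vazirani 1997, Def. 8; Yao 1993). `BQP` is the
class of languages `L ⊆ {0,1}*` decided by poly-time-uniform quantum circuit families over the
finite universal gate set `{H, S, T, CNOT}` (Clifford+T), error `≤ 1/3`: `L ∈ BQP` iff there is
an oracle-free, poly-time uniform family `F` of Clifford+T circuits such that, measuring wire `0`
after running `F` on `|x⟩|0…0⟩`, the acceptance probability is `≥ 2/3` for `x ∈ L` and `≤ 1/3`
for `x ∉ L`. (Unfolding of `Literature.CryptoQuantFine.BQP = BQPWith cliffordT (1/3)`.) Downstream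
files opening both `Literature.PQC` and `Literature.CryptoQuantFine` see this name shadow the prelude's
`Literature.Computability.Cryptography.ClassBQP.mem_BQP_iff` (same statement, `L` explicit here). [cite: BernsteinVazirani1997, Def. 8] -/
theorem Shor.mem_BQP_iff (L : Language Bool) :
    L ∈ BQP ↔ ∃ F : QCircuitFamily cliffordT, F.IsOracleFree ∧ F.IsUniform ∧
      ∀ x, (x ∈ L → 2 / 3 ≤ F.acceptProbOn 0 x) ∧ (x ∉ L → F.acceptProbOn 0 x ≤ 1 / 3) :=
  Literature.Computability.Cryptography.ClassBQP.mem_BQP_iff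

/-! ### pqc.S06: Shor's theorem, factoring -/

/-- **pqc.S06** (Shor 1997, §5; decision form). `FACT ∈ BQP`: the language of pairs `⟨N, k⟩`
such that `N` has a divisor `1 < d ≤ k` is decided in bounded-error quantum polynomial time
(compute the prime factorisation of `N` by Shor's order-finding algorithm and compare its least
element with `k`). [cite: Shor1997, §5] -/
def FACT_mem_BQP : Prop :=
  QuantumComplexity.FACT ∈ BQP

/-- **pqc.S06** (Shor 1997, §5, Theorem on factoring; FBQP form). The prime factorisation
function `Nat.primeFactorsList` is computable in bounded-error quantum polynomial
time: some poly-time uniform, oracle-free Clifford+T family, run on the binary encoding `x` of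
`N` and measured on all wires, outputs with probability `≥ 2/3` a string whose prefix is the
Boolean encoding (`encodingListNatBool = encodingNatBool.listBool`) of the list of prime factors of `N = decodeNat x`
(with multiplicity, in nondecreasing order). [cite: Shor1997, §5  Theorem on factoring] -/
def isQSolvable_factoring : Prop :=
  IsQSolvable fun x => {y | encodingListNatBool.encode (decodeNat x).primeFactorsList <+: y}

/-- Equivalently, `Nat.primeFactorsList ∘ decodeNat`, transported to Boolean strings, lies in `FBQP`.
[Shor 1997, §5] [cite: Shor1997, §5] -/
def factoring_mem_FBQP : Prop :=
  (fun x => encodingListNatBool.encode (decodeNat x).primeFactorsList) ∈ FBQP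

/- interim proof relied on results that are now named facts (D-0014); demoted to a fact by the M5 import, proof preserved:
:=
  isQSolvable_factoring
-/

/-! ### pqc.S06: Shor's theorem, discrete logarithms -/

/-- `IsDLogInstance p g y`: `(p, g, y)` is an instance of the discrete logarithm problem in the
sense of Shor: `p` is prime, `g` is a primitive root modulo `p` given as a residue `0 < g < p`
(its multiplicative order in `ZMod p` is `p - 1`; for prime `p` this is Mathlib's
`IsPrimitiveRoot (g : ZMod p) (p - 1)`), and `y` is a unit residue `0 < y < p`.
[Shor 1997, §6, first paragraph] [cite: Shor1997, §6  first paragraph] -/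
def IsDLogInstance (p g y : ℕ) : Prop :=
  p.Prime ∧ 0 < g ∧ g < p ∧ orderOf (g : ZMod p) = p - 1 ∧ 0 < y ∧ y < p

/-- `dlogSolutions p g y`: the discrete logarithms of `y` to the base `g` modulo `p`, i.e. the
exponents `a < p - 1` with `g ^ a ≡ y [MOD p]` (for a prime `p ≥ 2`, a primitive root `g` and
a unit `y` there is exactly one such `a`; the bound `p - 1` is the group order, no junk
subtraction on instances). [Shor 1997, §6] [cite: Shor1997, §6] -/
def dlogSolutions (p g y : ℕ) : Set ℕ :=
  {a | a < p - 1 ∧ g ^ a ≡ y [MOD p]}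

/-- The Boolean input encoding of a discrete-log instance `(p, g, y)`: the iterated pair
encoding `⟨p, ⟨g, y⟩⟩` of the binary encodings (G01 `pairBool`/`boolPair`). [Shor 1997, §6] [cite: Shor1997, §6] -/
def encodeDLogInstance (p g y : ℕ) : List Bool :=
  (encodingNatBool.pairBool (encodingNatBool.pairBool encodingNatBool)).encode (p, (g, y))

/-- Membership in `dlogSolutions`, unfolded. [Shor 1997, §6] [cite: Shor1997, §6] -/
@[simp] theorem mem_dlogSolutions (p g y a : ℕ) :
    a ∈ dlogSolutions p g y ↔ a < p - 1 ∧ g ^ a ≡ y [MOD p] :=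
  Iff.rfl

/-- The instance encoding is injective (so the relation in `isQSolvable_dlog` is well defined
instance-wise). [Shor 1997, §6] [cite: Shor1997, §6] -/
theorem encodeDLogInstance_injective :
    Function.Injective fun t : ℕ × ℕ × ℕ => encodeDLogInstance t.1 t.2.1 t.2.2 := fun _ _ h =>
  (encodingNatBool.pairBool (encodingNatBool.pairBool encodingNatBool)).encode_injective h

/-- Every discrete-log instance has exactly one solution: a primitive root generates all units
modulo `p`, and its order is `p - 1`.
[Shor 1997, §6] [cite: Shor1997, §6] -/
def existsUnique_mem_dlogSolutions : Prop :=
  ∀ {p g y : ℕ} (h : IsDLogInstance p g y),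
    ∃! a, a ∈ dlogSolutions p g y

/-- **pqc.S06** (Shor 1997, §6, discrete logarithms). The discrete logarithm problem is solvable
in bounded-error quantum polynomial time: some poly-time uniform, oracle-free Clifford+T family,
run on the encoding of an instance `(p, g, y)` (`p` prime, `g` a primitive root mod `p`, `y` a
unit mod `p`) and measured on all wires, outputs with probability `≥ 2/3` a string whose prefix
is the binary encoding of the `a < p - 1` with `g ^ a ≡ y [MOD p]`. On inputs that do not encode a valid
instance nothing is required. [cite: Shor1997, §6  discrete logarithms] -/
def isQSolvable_dlog : Prop :=
  IsQSolvable fun x => {out | ∀ p g y : ℕ, x = encodeDLogInstance p g y →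
      IsDLogInstance p g y → ∃ a ∈ dlogSolutions p g y, encodeNat a <+: out}

end Literature.Computability.Cryptography

end
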